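import Summits.QuantumFields.YangMills.Theses.SpecificationCompactness
import Summits.QuantumFields.YangMills.Theorems.SpecificationCompactnessWeakLimitDLR
import Summits.QuantumFields.YangMills.Theorems.SpecificationCompactnessDLRUniqueness
import Literature.MathematicalPhysics.QuantumFieldTheory.Balaban1983to89.T3HeightwiseDensityBounds
import Literature.MathematicalPhysics.QuantumFieldTheory.Balaban1983to89.T3OrbitAverage

/-!
# `TailTrivialUniqueness` (route `SpecificationCompactness`, LINE 14 «tail_trivial_kernel», support S2° = THE NEW KERNEL,
# stmt-QuantumFields-22690) — PROVED

For every torus family `F`, `γ > 0` and single-link profiles `q_e` (measurable, `≥ 0`, `> 0` π₀-a.e., fibre-normalised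
`π₀[q_e | links ≠ e] = 1` a.e.): if `∫ |ũ_K − π₀[ũ_K | links ≠ e]·q_e| dπ₀ → 0` for every unit link `e` (the conclusion of
`DensityMergingAE`) and the normalised unit densities `ũ_K = ρ̂_K/∫ρ̂_K` are uniformly integrable, then EVERY continuous `f` on
`X₀ = SU(2)^{unit bonds}` has a limit `lim_K ∫ f dρ_K`, `ρ_K = unitLaw expMeanLogSU γ K = ũ_K·π₀`.

PROOF (no Doeblin, no Feller/continuity, no Prokhorov): (1) Dunford–Pettis (tree `exists_subseq_tendstoWeaklyL1_of_stronglyMeasurable`):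
every subsequence of `(ũ_K)` has a sub-subsequence converging weakly in `L¹(π₀)`; (2) every such weak limit `g` is a DLR density —
`g = π₀[g | links ≠ e]·q_e` a.e. for every `e`, `g ≥ 0`, `∫ g = 1` (`SpecificationCompactnessWeakLimitDLR`); (3) DLR densities are
UNIQUE (`SpecificationCompactnessDLRUniqueness`: the minimum of two DLR densities is DLR, and tail triviality on the finite product
makes every non-zero non-negative DLR density a.e. positive); (4) hence all subsequential limits of `∫ ũ_K f dπ₀` agree
(`tendsto_of_subseq_tendsto`).

HONEST FRAMING.  Measure theory only (rung R3 RECORD line): the cruxes `SpecificationLimitAE` / `UnitDensityUI` stay hypotheses of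
the route; nothing is proved about them, about `ContinuumYM3Torus`, or about the YM mass gap.  No definitions, no named facts.
[folklore] ([cite: FonsecaLeoni2007, Thm 2.54]; [cite: Georgii2011, Thm 4.17]; [cite: Balaban1985UV3, (2) p.256] for the unit laws.)
-/

noncomputable section

namespace Summit.QuantumFields.YangMills.Theorems.SpecificationCompactnessTailTrivial

open MeasureTheory Filter Topology Function Set
open Literature.Analysis.FunctionSpaces
open Summit.QuantumFields.YangMills.Theorems.SpecificationCompactnessKernel
open Summit.QuantumFields.YangMills.Theorems.SpecificationCompactnessDensityMerging
open Summit.QuantumFields.YangMills.Theorems.SpecificationCompactnessWeakLimit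
open Summit.QuantumFields.YangMills.Theorems.SpecificationCompactnessDLR
open Literature.MathematicalPhysics.QuantumFieldTheory.Balaban1983to89
open Literature.MathematicalPhysics.QuantumFieldTheory.Balaban1983to89.T3ContinuumYM3Torus
open Literature.MathematicalPhysics.QuantumFieldTheory.Balaban1983to89.Missing
open Literature.MathematicalPhysics.QuantumFieldTheory.Balaban1983to89.T4Continuum
open Literature.MathematicalPhysics.QuantumFieldTheory.Balaban1983to89.T3ThresholdRemoval
open Literature.MathematicalPhysics.QuantumFieldTheory.Balaban1983to89.T3UnitLawDensityEML
open Literature.MathematicalPhysics.QuantumFieldTheory.Balaban1983to89.T3OrbitAverage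

/-- **`TailTrivialUniqueness` (route `SpecificationCompactness`, support S2°, stmt-QuantumFields-22690) HOLDS.**  Dunford–Pettis
sub-subsequences + DLR property of weak-`L¹` limits + uniqueness of DLR densities (tail triviality) + the subsequence principle.
Rung R3 RECORD line; no crux, no instance of `ContinuumYM3Torus` and nothing about the YM mass gap is proved here.
[cite: FonsecaLeoni2007, Thm 2.54] -/
theorem tailTrivialUniqueness_proof :
    Summit.QuantumFields.YangMills.Theses.SpecificationCompactness.TailTrivialUniqueness := by
  intro F γ hγ q hq hmerge hUI f hf
  obtain ⟨hqm, hq0, hqpos, hq1⟩ := hq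
  classical
  -- the setting: `π₀` = product Haar on `X₀ = SU(2)^{unit bonds}`
  haveI hηP : IsProbabilityMeasure (HaarData.haar : Measure (Matrix.specialUnitaryGroup (Fin 2) ℂ)) := HaarData.isProb
  set η : Measure (Matrix.specialUnitaryGroup (Fin 2) ℂ) := HaarData.haar with hη
  set π₀ : Measure (GaugeField (F.P 0) 0 (Matrix.specialUnitaryGroup (Fin 2) ℂ)) :=
    fieldMeasure (F.P 0) 0 (Matrix.specialUnitaryGroup (Fin 2) ℂ) with hπ₀
  haveI : IsProbabilityMeasure π₀ := Missing.isProbabilityMeasure_fieldMeasure (F.P 0) 0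
  have hπ₀pi : π₀ = Measure.pi fun _ : PBond (F.P 0) 0 => η := rfl
  have hm : ∀ e : PBond (F.P 0) 0, MeasurableSpace.comap (fun (W : GaugeField (F.P 0) 0 (Matrix.specialUnitaryGroup (Fin 2) ℂ))
      (b : {b : PBond (F.P 0) 0 // b ≠ e}) => W b.1) MeasurableSpace.pi ≤
      (inferInstance : MeasurableSpace (GaugeField (F.P 0) 0 (Matrix.specialUnitaryGroup (Fin 2) ℂ))) :=
    fun e => Measurable.comap_le (measurable_pi_lambda _ fun b => measurable_pi_apply (b.1 : PBond (F.P 0) 0))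
  -- the normalised densities `u K = ũ_K`
  obtain hprops := fun K => unitDensity_props F K hγ.le
  set u : ℕ → GaugeField (F.P 0) 0 (Matrix.specialUnitaryGroup (Fin 2) ℂ) → ℝ :=
    fun K V => (∫ W, unitDensity F γ K W ∂π₀)⁻¹ * unitDensity F γ K V with hu
  have hZ : ∀ K, 0 < ∫ W, unitDensity F γ K W ∂π₀ := by
    -- (the same computation as the landed `integral_unitDensity_pos`, inlined to keep this file's imports
    -- route-independent apart from the route file itself)
    intro K
    obtain ⟨hdm, hd0, -⟩ := hprops K
    have hZp : 0 < partitionFn (G := Matrix.specialUnitaryGroup (Fin 2) ℂ) (F.P K) ((F.scheme ℰp γ).β K) :=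
      partitionFn_pos' _ (F.scheme_β_nonneg ℰp hγ.le K)
    set Z := partitionFn (G := Matrix.specialUnitaryGroup (Fin 2) ℂ) (F.P K) ((F.scheme ℰp γ).β K) with hZdef
    haveI := isProbabilityMeasure_unitLaw (F := F) (ℰ := ℰp) measurableE_ℰp hγ.le K
    have h1 : ∫ _u, (1 : ℝ) ∂F.unitLaw ℰp measurableE_ℰp γ K = 1 := by simp
    rw [unitLaw_eq_withDensity_emlDensity F K hγ.le] at h1
    have h2 := integral_lawOf (π := π₀) (u := fun u => Z⁻¹ * unitDensity F γ K u) (hdm.const_mul _)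
      (fun u => mul_nonneg (inv_nonneg.mpr hZp.le) (hd0 u)) (fun _ => (1 : ℝ))
    rw [h2] at h1
    simp only [mul_one, integral_const_mul] at h1
    have hinv : 0 < Z⁻¹ := inv_pos.mpr hZp
    nlinarith
  have hum : ∀ K, Measurable (u K) := fun K => (hprops K).1.const_mul _
  have hu0 : ∀ K x, 0 ≤ u K x := fun K x => mul_nonneg (inv_nonneg.mpr (hZ K).le) ((hprops K).2.1 x)
  have hui : ∀ K, Integrable (u K) π₀ := fun K => (hprops K).2.2.const_mul _
  have hu1 : ∀ K, ∫ V, u K V ∂π₀ = 1 := fun K => by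
    simp only [hu]
    rw [integral_const_mul, inv_mul_cancel₀ (hZ K).ne']
  -- `ρ_K = ũ_K·π₀`, so `∫ f dρ_K = ∫ ũ_K f dπ₀`
  have hρ : ∀ K, F.unitLaw (ExpMeanLog.expMeanLogSU : LoopAverage (Matrix.specialUnitaryGroup (Fin 2) ℂ))
      T4ApexTwoLevel.measurableE_expMeanLogSU γ K = π₀.withDensity (fun V => ENNReal.ofReal (u K V)) := fun K => by
    have h := unitLaw_eq_withDensity_emlDensity F K hγ.le
    have hZ' : ∫ W, unitDensity F γ K W ∂π₀ =
        partitionFn (G := Matrix.specialUnitaryGroup (Fin 2) ℂ) (F.P K) ((F.scheme ℰp γ).β K) := by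
      -- both normalisations give probability measures with the same un-normalised density
      have hP : IsProbabilityMeasure (π₀.withDensity fun V => ENNReal.ofReal
          ((partitionFn (G := Matrix.specialUnitaryGroup (Fin 2) ℂ) (F.P K) ((F.scheme ℰp γ).β K))⁻¹ * unitDensity F γ K V)) := by
        rw [← h]; exact isProbabilityMeasure_unitLaw (F := F) (ℰ := ℰp) measurableE_ℰp hγ.le K
      have h1 := hP.measure_univ
      rw [withDensity_apply _ MeasurableSet.univ, Measure.restrict_univ] at h1
      have hZp : 0 < partitionFn (G := Matrix.specialUnitaryGroup (Fin 2) ℂ) (F.P K) ((F.scheme ℰp γ).β K) :=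
        partitionFn_pos' _ (F.scheme_β_nonneg ℰp hγ.le K)
      have hnn : ∀ V, 0 ≤ (partitionFn (G := Matrix.specialUnitaryGroup (Fin 2) ℂ) (F.P K) ((F.scheme ℰp γ).β K))⁻¹ *
          unitDensity F γ K V := fun V => mul_nonneg (inv_nonneg.mpr hZp.le) ((hprops K).2.1 V)
      have h2 : ∫ V, (partitionFn (G := Matrix.specialUnitaryGroup (Fin 2) ℂ) (F.P K) ((F.scheme ℰp γ).β K))⁻¹ *
          unitDensity F γ K V ∂π₀ = 1 := by
        have hi : Integrable (fun V => (partitionFn (G := Matrix.specialUnitaryGroup (Fin 2) ℂ) (F.P K)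
            ((F.scheme ℰp γ).β K))⁻¹ * unitDensity F γ K V) π₀ := (hprops K).2.2.const_mul _
        have h3 := (ofReal_integral_eq_lintegral_ofReal hi (Eventually.of_forall hnn)).symm
        rw [h1] at h3
        have h4 := congrArg ENNReal.toReal h3
        rwa [ENNReal.toReal_ofReal (integral_nonneg hnn), ENNReal.toReal_one, eq_comm] at h4
      rw [integral_const_mul] at h2
      field_simp at h2
      linarith
    rw [hu]
    simp only [hZ']
    exact h
  have hintf : ∀ K, ∫ V, f V ∂F.unitLaw (ExpMeanLog.expMeanLogSU : LoopAverage (Matrix.specialUnitaryGroup (Fin 2) ℂ))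
      T4ApexTwoLevel.measurableE_expMeanLogSU γ K = ∫ V, u K V * f V ∂π₀ := fun K => by
    rw [hρ K]; exact integral_lawOf (hum K) (hu0 K) f
  simp_rw [hintf]
  -- `f` is bounded and measurable (compact `X₀`)
  obtain ⟨C, hC⟩ := isCompact_univ.exists_bound_of_continuousOn (hf.continuousOn (s := Set.univ))
  have hfC : ∀ᵐ V ∂π₀, |f V| ≤ C := Eventually.of_forall fun V => by
    have := hC V (Set.mem_univ V); rwa [Real.norm_eq_abs] at this
  have hfm : AEStronglyMeasurable f π₀ := hf.aestronglyMeasurable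
  -- uniform integrability, Dunford–Pettis inputs
  have hUIm : UniformIntegrable u 1 π₀ := uniformIntegrable_of_tail hum hu0 hui hUI
  -- the DLR property of weak limits along subsequences, in measurable versions
  have hlimit : ∀ (ns : ℕ → ℕ), Tendsto ns atTop atTop → ∀ g : GaugeField (F.P 0) 0 (Matrix.specialUnitaryGroup (Fin 2) ℂ) → ℝ,
      Integrable g π₀ → TendstoWeaklyL1 (u ∘ ns) g π₀ →
      ∃ g' : GaugeField (F.P 0) 0 (Matrix.specialUnitaryGroup (Fin 2) ℂ) → ℝ, Measurable g' ∧ Integrable g' π₀ ∧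
        g =ᵐ[π₀] g' ∧ (∫ V, g' V ∂π₀ = 1) ∧
        ∀ e, g' =ᵐ[π₀] fun V => π₀[g'|MeasurableSpace.comap (fun (W : GaugeField (F.P 0) 0
          (Matrix.specialUnitaryGroup (Fin 2) ℂ)) (b : {b : PBond (F.P 0) 0 // b ≠ e}) => W b.1) MeasurableSpace.pi] V * q e V := by
    intro ns hns g hgi hweak
    set g' := hgi.1.mk g with hg'
    have hae : g =ᵐ[π₀] g' := hgi.1.ae_eq_mk
    have hg'm : Measurable g' := hgi.1.stronglyMeasurable_mk.measurable
    have hg'i : Integrable g' π₀ := hgi.congr hae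
    have hweak' : TendstoWeaklyL1 (u ∘ ns) g' π₀ := by
      intro φ B hφ hφB
      have h := hweak φ B hφ hφB
      have heq : ∫ V, g V * φ V ∂π₀ = ∫ V, g' V * φ V ∂π₀ :=
        integral_congr_ae (hae.mono fun V hV => by show g V * φ V = g' V * φ V; rw [hV])
      rwa [heq] at h
    refine ⟨g', hg'm, hg'i, hae, integral_eq_of_tendstoWeaklyL1 (fun K => hu1 (ns K)) hweak', fun e => ?_⟩
    exact dlr_of_tendstoWeaklyL1 (hm e) (fun K => hui (ns K)) (hqm e) (hq0 e) (hq1 e) ((hmerge e).comp hns) hg'i hweak'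
  -- Step A: one weak limit
  obtain ⟨ψ₀, hψ₀, g₀, hg₀i, hg₀w⟩ := exists_subseq_tendstoWeaklyL1_of_stronglyMeasurable (μ := π₀)
    (fun K => (hum K).stronglyMeasurable) hUIm (unifTight_one_of_isFiniteMeasure u)
  obtain ⟨G₀, hG₀m, hG₀i, hG₀ae, hG₀1, hG₀dlr⟩ := hlimit ψ₀ hψ₀.tendsto_atTop g₀ hg₀i hg₀w
  refine ⟨∫ V, G₀ V * f V ∂π₀, ?_⟩
  -- Step B: every subsequence has a sub-subsequence converging to the same limit
  refine tendsto_of_subseq_tendsto (fun ns hns => ?_)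
  obtain ⟨ms, hms, g₁, hg₁i, hg₁w⟩ := exists_subseq_tendstoWeaklyL1_of_stronglyMeasurable (μ := π₀)
    (f := u ∘ ns) (fun K => (hum (ns K)).stronglyMeasurable) (uniformIntegrable_comp_seq hUIm ns)
    (unifTight_one_of_isFiniteMeasure _)
  obtain ⟨G₁, hG₁m, hG₁i, hG₁ae, hG₁1, hG₁dlr⟩ :=
    hlimit (ns ∘ ms) (hns.comp hms.tendsto_atTop) g₁ hg₁i hg₁w
  -- uniqueness of DLR densities: `G₁ = G₀` a.e.
  have heq : G₁ =ᵐ[π₀] G₀ :=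
    dlr_density_unique η hqm hq0 hqpos hq1 hG₁m hG₀m hG₁i hG₀i (hG₁1.trans hG₀1.symm) hG₁dlr hG₀dlr
  refine ⟨ms, ?_⟩
  have h := hg₁w f C hfm hfC
  have h1 : ∫ V, g₁ V * f V ∂π₀ = ∫ V, G₀ V * f V ∂π₀ :=
    integral_congr_ae ((hG₁ae.trans heq).mono fun V hV => by show g₁ V * f V = G₀ V * f V; rw [hV])
  rw [h1] at h
  exact h

end Summit.QuantumFields.YangMills.Theorems.SpecificationCompactnessTailTrivial

end
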